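/-
Copyright (c) 2026 the pub-hodgecm-mathlib formalisation cell (harness21).  Prover seat hodgecm-mathlib-F0P3b-p01 (g26); E1 keeper ∕ dealer F0P3a-p03 (g31) k23
«= cut + order» 2026-09-03T05:24:36Z on CENSUS-R68 v1 607db827 (E1 BRICK LEDGER row 68-C «JACQUET OF THE DIRECT SUM IS ISOTYPIC»).
-/
import Literature.NumberTheory.Automorphic.JacquetLineExponents      -- ★ `Representation.jacquetMap_normalizedJacquet` (brings ★ `JacquetModule`: `jacquetMap`, `normalizedJacquet`, `Coinvariants`)
import HarnessLib

/-!
# The normalised Jacquet module of a sum `A + A′ = V` of invariant submodules on each of which `M` acts by the character `χ` is `χ`-isotypic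

Generic representation theory (topological group `G`, parabolic triple `t = (P, M, N)`, complex coefficients; ★ `JacquetModule` ∕ ★ `JacquetLineExponents` + Mathlib;
THEOREMS ONLY — no definition, no instance, no named fact).  Namespace `Representation` (dot-lemmas on ★ `Representation.normalizedJacquet`).  Cell `pub/hodgecm-mathlib`, crux
H413 = `stmt-HodgeConjecture-24833` (`--supports` lane, count-neutral helper); E1 BRICK LEDGER row 68-C (census `F0/P3/F0P3b-p01/g26/r68/CENSUS-R68-K4primeUNR.v1.md` §3): the
`hss` letter («`r_P I₀` is `χ`-isotypic semisimple») of the jet-intertwiner brick (O1) of the K4′ cell, at `I₀ = i_B(θ̃) = π⁺ ⊕ π⁻` in case (3) of [Rogawski1990, §12.2]: each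
summand has `r_B ≅ θ̃` (★ E1 row 64-B), the Jacquet functor is additive (right exact, [BernsteinZelevinsky1977, §1.8; Casselman1995, Prop. 3.2.3]), so `M` acts by `θ̃` on all of
`r_B I₀` — a SPLIT self-extension of the character, the signature of the reducibility `R(θ̃) ≅ ℤ∕2` [Keys1984, §4 Thm. 3].
* §1 `subtypeIntertwiningMap_eq` ∕ `jacquetMap_subtype_normalizedJacquet`: the inclusion `A ↪ V` as an intertwiner of `ρ.subrepresentation A hA` into `ρ`, and the NORMALISED
  Jacquet actions along it (★ `jacquetMap_normalizedJacquet`).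
* §2 **`normalizedJacquet_eq_smul_of_sup_eq_top`**: if `A ⊔ A′ = ⊤` (invariant `A, A′`) and `M` acts by `χ` on `r_P(ρ|_A)` and on `r_P(ρ|_{A′})`, then `M` acts by `χ` on `r_P ρ`.
HONEST LABEL: count-neutral generic helper; nothing printed is asserted; h413 OPEN; HC_CM is proved only modulo the 7 printed citations (2 remaining named inputs hLiu418 =
stmt-HodgeConjecture-24832, h413 = stmt-HodgeConjecture-24833) until rung 0 closes.

## References
* [BernsteinZelevinsky1977] I. N. Bernstein, A. V. Zelevinsky, *Induced representations of reductive p-adic groups I*, Ann. Sci. ÉNS 10 (1977), §1.8, §2.3.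
* [Casselman1995] W. Casselman, *Introduction to the theory of admissible representations of p-adic reductive groups* (1995), §3.1, Prop. 3.2.3.
* [Rogawski1990] J. D. Rogawski, *Automorphic Representations of Unitary Groups in Three Variables*, Ann. of Math. Stud. 123 (1990), §12.2 (3) pp. 173–174.
* [Keys1984] D. Keys, *Principal series representations of special unitary groups over local fields*, Compositio Math. 51 (1984), §4 Thm. 3 p. 120.
-/

set_option autoImplicit false

noncomputable section

namespace Representation

open Literature.NumberTheory.Automorphic

variable {G : Type*} [Group G] [TopologicalSpace G] [IsTopologicalGroup G]
  (t : ParabolicTriple G) [LocallyCompactSpace t.P]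
  {V : Type*} [AddCommGroup V] [Module ℂ V] (ρ : Representation ℂ G V)
  {A : Submodule ℂ V} (hA : ∀ g, A ≤ A.comap (ρ g))

/-! ## §1 The inclusion of an invariant submodule and the normalised Jacquet actions along it -/

omit [TopologicalSpace G] [IsTopologicalGroup G] [LocallyCompactSpace t.P] t in
/-- **The inclusion `A ↪ V` intertwines `ρ|_A` and `ρ`**: there is an intertwiner `ρ.subrepresentation A hA →ᴳ ρ` which is the subtype map on vectors (Mathlib
`Representation.subrepresentation` is the restriction of `ρ`). [cite: BernsteinZelevinsky1977, §1.8] -/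
theorem exists_subtypeIntertwiningMap :
    ∃ ι : (ρ.subrepresentation A hA).IntertwiningMap ρ, ∀ a : A, ι a = (a : V) :=
  ⟨LinearMap.intertwiningMap_of_isIntertwiningMap _ _ A.subtype (fun g a => by
      rw [Submodule.subtype_apply, Submodule.subtype_apply, Representation.subrepresentation_apply, LinearMap.coe_restrict_apply]),
    fun a => rfl⟩

/-- **Along the inclusion the NORMALISED Jacquet actions agree**: `r_P(ι) (r_P(ρ|_A)(m) y) = r_P(ρ)(m) (r_P(ι) y)` (★ `jacquetMap_normalizedJacquet`), so if `M` acts by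
`χ` on `r_P(ρ|_A)` it acts by `χ` on the image of `r_P(ρ|_A)` in `r_P ρ`. [cite: BernsteinZelevinsky1977, §1.8; §2.3] [cite: Casselman1995, §3.1] -/
theorem normalizedJacquet_jacquetMap_eq_smul (ι : (ρ.subrepresentation A hA).IntertwiningMap ρ) (χ : ↥t.M →* ℂ)
    (hchar : ∀ (m : ↥t.M) (y : (t.restrict (ρ.subrepresentation A hA)).Coinvariants), (ρ.subrepresentation A hA).normalizedJacquet t m y = χ m • y)
    (m : ↥t.M) (y : (t.restrict (ρ.subrepresentation A hA)).Coinvariants) :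
    ρ.normalizedJacquet t m (jacquetMap t ι y) = χ m • jacquetMap t ι y := by
  rw [← jacquetMap_normalizedJacquet, hchar, map_smul]

/-! ## §2 `M` acts by `χ` on the Jacquet module of `A + A′ = V` -/

/-- **THE JACQUET MODULE OF `A + A′ = V` IS `χ`-ISOTYPIC** when `M` acts by `χ` on `r_P(ρ|_A)` and on `r_P(ρ|_{A′})` (invariant `A, A′` with `A ⊔ A′ = ⊤`): every class
`[v] ∈ r_P ρ` is `[a] + [a′] = r_P(ι_A)[a] + r_P(ι_{A′})[a′]`, and `M` acts by `χ` on both images (§1).  At `I₀ = i_B(θ̃) = π⁺ ⊕ π⁻` (case (3)): `r_B I₀` is the SPLIT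
self-extension `θ̃ ⊕ θ̃` — the `hss` letter of the K4′ jet intertwiner. [cite: BernsteinZelevinsky1977, §1.8; §2.3] [cite: Casselman1995, Prop. 3.2.3]
[cite: Rogawski1990, §12.2 (3) pp. 173–174] [cite: Keys1984, §4 Thm. 3 p. 120] -/
theorem normalizedJacquet_eq_smul_of_sup_eq_top {A' : Submodule ℂ V} (hA' : ∀ g, A' ≤ A'.comap (ρ g)) (hsup : A ⊔ A' = ⊤) (χ : ↥t.M →* ℂ)
    (hcharA : ∀ (m : ↥t.M) (y : (t.restrict (ρ.subrepresentation A hA)).Coinvariants), (ρ.subrepresentation A hA).normalizedJacquet t m y = χ m • y)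
    (hcharA' : ∀ (m : ↥t.M) (y : (t.restrict (ρ.subrepresentation A' hA')).Coinvariants), (ρ.subrepresentation A' hA').normalizedJacquet t m y = χ m • y)
    (m : ↥t.M) (x : (t.restrict ρ).Coinvariants) :
    ρ.normalizedJacquet t m x = χ m • x := by
  obtain ⟨ι, hι⟩ := exists_subtypeIntertwiningMap ρ hA
  obtain ⟨ι', hι'⟩ := exists_subtypeIntertwiningMap ρ hA'
  obtain ⟨v, rfl⟩ := Representation.Coinvariants.mk_surjective (t.restrict ρ) x
  have hv : v ∈ A ⊔ A' := by rw [hsup]; exact Submodule.mem_top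
  obtain ⟨a, ha, a', ha', rfl⟩ := Submodule.mem_sup.1 hv
  have hsplit : Representation.Coinvariants.mk (t.restrict ρ) (a + a') =
      jacquetMap t ι (Representation.Coinvariants.mk (t.restrict (ρ.subrepresentation A hA)) ⟨a, ha⟩) +
        jacquetMap t ι' (Representation.Coinvariants.mk (t.restrict (ρ.subrepresentation A' hA')) ⟨a', ha'⟩) := by
    rw [jacquetMap_mk, jacquetMap_mk, hι, hι', ← map_add]
  rw [hsplit, map_add, smul_add, normalizedJacquet_jacquetMap_eq_smul t ρ hA ι χ hcharA, normalizedJacquet_jacquetMap_eq_smul t ρ hA' ι' χ hcharA']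

end Representation

end
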